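import Literature.Analysis.FluidPDE.LeslieShvydkoy2018MorreyBound
import Literature.Analysis.FluidPDE.NormalisedPressureDischarge
import Literature.Analysis.FluidPDE.NSLerayBlowupRateTopHolds
import Mathlib.Analysis.SpecialFunctions.Integrals.Basic
import HarnessLib

/-!
# Leslie–Shvydkoy 2018, Prop. 3.2 / 4.2: the first-blow-up frame under a power-law sup rate

Analysis/FluidPDE proofs file (theorems only; no definitions, no named facts) on the discharge
path of the named fact `Literature.Analysis.FluidPDE.leslieShvydkoy2018_morreyBound`
(`LeslieShvydkoy2018MorreyBound.lean`; T. M. Leslie, R. Shvydkoy, ARMA 230 (2018) =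
arXiv:1705.04420, Prop. 3.2 + 4.2). It collects what the discharge
(`LeslieShvydkoy2018MorreyBoundHolds.lean`) needs about the tree's first-blow-up frame — a maximal
smooth solution `(u, p)` on `[0,T)`, Leray–Hopf from its datum, `ν > 0`, with the rate
`‖u(t,x)‖ ≤ c₀ (T-t)^{-1/q}` of Prop. 3.2:

* `rate_const_nonneg`, `eLpNorm_top_le_rate`, `eLpNorm_uncurry_lt_top_of_rate` — bookkeeping of
  the rate hypothesis (`c₀ ≥ 0`; `‖u(t)‖_∞ ≤ c₀(T-t)^{-1/q}`; boundedness on closed slabs);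
* `false_of_rate_of_two_lt` — **for `q > 2` the hypotheses are contradictory**: the paper's "the
  conclusion is trivial whenever `q > 2`, by the Prodi–Serrin criterion" (p. 13) becomes, on the
  frame, the incompatibility of the rate with Leray's lower blow-up rate
  `‖u(t)‖_∞ ≥ c√ν (T-t)^{-1/2}` (`leray_blowup_rate_top_holds`, Leray 1934 (3.9));
* `lintegral_sq_le_energy` — the Leray–Hopf energy bound `∫|u(t)|² ≤ 2E(u₀)` (§2.3 of the paper:
  the strong solution is Leray–Hopf);
* `ae_pressure_gauge_slab` — the classical pressure is the normalised pressure `RᵢRⱼ(uᵢuⱼ)` up to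
  a constant at a.e. time of every slab `(0, T')`, `T' < T` (Tao 2011, Lemma 4.1 (i), the tree's
  `tao_pressure_normalisation_holds`; the paper's standing convention `p = RᵢRⱼ(uᵢuⱼ)`, §1 p. 3);
* `integral_rate_le`, `lintegral_rate_le` — the kernel integral (3.13):
  `∫_{t₀}^{t} (T-τ)^{-1/q} dτ ≤ (T-t₀)^{1-1/q}/(1-1/q)`.

## References

* T. M. Leslie, R. Shvydkoy, ARMA 230 (2018) = arXiv:1705.04420, Prop. 3.2 (p. 9), (3.13)
  (p. 11), §4 (p. 13). [`LeslieShvydkoy2017`]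
* J. Leray, Acta Math. 63 (1934), §20 (3.9). [`Leray1934`]
* T. Tao, Anal. PDE 6 (2013) = arXiv:1108.1165, Lemma 4.1 (i). [`Tao2011`]
-/

noncomputable section

open MeasureTheory Set Metric Filter Function InnerProductSpace
open _root_.Topology
open scoped ENNReal NNReal RealInnerProductSpace

namespace Literature.Analysis.FluidPDE

namespace LeslieShvydkoy2018

variable {ν T q c₀ : ℝ} {u : ℝ → EuclideanSpace ℝ (Fin 3) → EuclideanSpace ℝ (Fin 3)}
  {p : ℝ → EuclideanSpace ℝ (Fin 3) → ℝ}

/-! ### The rate hypothesis -/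

/-- The rate constant is nonnegative (evaluate the rate at `t = 0`).
[cite: LeslieShvydkoy2017, Prop. 3.2, hypothesis `‖u(t)‖_∞ ≤ c₀|t|^{-1/q}` (p. 9)] -/
theorem rate_const_nonneg (hT : 0 < T)
    (hc₀ : ∀ t ∈ Ico 0 T, ∀ x, ‖u t x‖ ≤ c₀ * (T - t) ^ (-(1 / q))) : 0 ≤ c₀ := by
  have h := hc₀ 0 (left_mem_Ico.2 hT) 0
  have hpos : 0 < (T - 0) ^ (-(1 / q)) := Real.rpow_pos_of_pos (by simpa using hT) _
  nlinarith [norm_nonneg (u 0 0)]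

/-- The `L^∞` norm of a slice under the rate.
[cite: LeslieShvydkoy2017, Prop. 3.2, hypothesis `‖u(t)‖_∞ ≤ c₀|t|^{-1/q}` (p. 9)] -/
theorem eLpNorm_top_le_rate (hc₀ : ∀ t ∈ Ico 0 T, ∀ x, ‖u t x‖ ≤ c₀ * (T - t) ^ (-(1 / q)))
    {t : ℝ} (ht : t ∈ Ico 0 T) :
    eLpNorm (u t) ∞ volume ≤ ENNReal.ofReal (c₀ * (T - t) ^ (-(1 / q))) := by
  rw [eLpNorm_exponent_top]
  exact eLpNormEssSup_le_of_ae_bound (ae_of_all _ fun x => hc₀ t ht x)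

/-- Under the rate the solution is bounded on every closed slab `[0, T'] × ℝ³`, `T' < T`
("regular on `[-1,0)`"). [cite: LeslieShvydkoy2017, Prop. 3.2, hypotheses (p. 9)] -/
theorem eLpNorm_uncurry_lt_top_of_rate (hc₀n : 0 ≤ c₀)
    (hc₀ : ∀ t ∈ Ico 0 T, ∀ x, ‖u t x‖ ≤ c₀ * (T - t) ^ (-(1 / q))) (hq : 0 < q)
    {T' : ℝ} (hT' : T' ∈ Ioo 0 T) :
    eLpNorm (uncurry u) ∞ (volume.restrict (Icc 0 T' ×ˢ (univ : Set (EuclideanSpace ℝ (Fin 3))))) < ∞ := by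
  rw [eLpNorm_exponent_top]
  refine eLpNormEssSup_lt_top_of_ae_bound (C := c₀ * (T - T') ^ (-(1 / q))) ?_
  refine ae_restrict_of_forall_mem (measurableSet_Icc.prod MeasurableSet.univ) fun z hz => ?_
  obtain ⟨ht, -⟩ := hz
  have htT : z.1 < T := ht.2.trans_lt hT'.2
  refine (hc₀ z.1 ⟨ht.1, htT⟩ z.2).trans (mul_le_mul_of_nonneg_left ?_ hc₀n)
  -- `(T - t)^{-1/q}` is antitone in `t`
  exact Real.rpow_le_rpow_of_nonpos (by linarith [hT'.2]) (by linarith [ht.2])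
    (by rw [neg_nonpos]; positivity)

/-! ### `q > 2`: the hypotheses are contradictory (Leray's lower rate) -/

/-- **For `q > 2` no first blow-up obeys the rate** ("the conclusion is trivial whenever `q > 2`,
by the Prodi–Serrin criterion", p. 13; on the tree's frame: Leray's lower bound
`‖u(t)‖_∞ ≥ c√ν (T-t)^{-1/2}`, `leray_blowup_rate_top_holds`, is incompatible with
`‖u(t)‖_∞ ≤ c₀(T-t)^{-1/q}`, `1/q < 1/2`, as `t → T`).
[cite: LeslieShvydkoy2017, §4, sentence before (4.1) (p. 13); Leray1934, §20 (3.9)] -/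
theorem false_of_rate_of_two_lt (hν : 0 < ν) (hT : 0 < T) (hq : 2 < q)
    (hmax : IsMaximalSmoothSolution ν 0 u p T) (hLH : IsLerayHopfOn T ν 0 (u 0) u)
    (hc₀ : ∀ t ∈ Ico 0 T, ∀ x, ‖u t x‖ ≤ c₀ * (T - t) ^ (-(1 / q))) : False := by
  obtain ⟨c, hc, hLeray⟩ := leray_blowup_rate_top_holds
  have hc₀n : 0 ≤ c₀ := rate_const_nonneg hT hc₀
  have hq0 : 0 < q := by linarith
  have hbdd : ∀ T' ∈ Ioo 0 T, eLpNorm (uncurry u) ∞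
      (volume.restrict (Icc 0 T' ×ˢ (univ : Set (EuclideanSpace ℝ (Fin 3))))) < ∞ :=
    fun T' hT' => eLpNorm_uncurry_lt_top_of_rate hc₀n hc₀ hq0 hT'
  -- the two-sided bound at every `t ∈ [0, T)`
  have hboth : ∀ t ∈ Ico 0 T, c * Real.sqrt ν / Real.sqrt (T - t) ≤ c₀ * (T - t) ^ (-(1 / q)) := by
    intro t ht
    have h := (hLeray ν T hν hT u p hmax hLH hbdd t ht).trans (eLpNorm_top_le_rate hc₀ ht)
    exact (ENNReal.ofReal_le_ofReal_iff (mul_nonneg hc₀n (Real.rpow_nonneg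
      (by linarith [ht.2]) _))).1 h
  -- the exponent gap
  set e : ℝ := 1 / 2 - 1 / q with he
  have he0 : 0 < e := by
    rw [he, sub_pos, one_div_lt_one_div (by linarith) (by norm_num)]; exact hq
  -- in terms of `s = T - t ∈ (0, T]`: `c √ν ≤ c₀ s^e`
  have hs : ∀ s ∈ Ioc 0 T, c * Real.sqrt ν ≤ c₀ * s ^ e := by
    intro s hs
    have ht : T - s ∈ Ico 0 T := ⟨by linarith [hs.2], by linarith [hs.1]⟩
    have h := hboth (T - s) ht
    rw [sub_sub_cancel] at h
    have hs0 : 0 < s := hs.1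
    rw [Real.sqrt_eq_rpow s, div_le_iff₀ (Real.rpow_pos_of_pos hs0 _)] at h
    -- `c₀ s^{-1/q} s^{1/2} = c₀ s^e`
    calc c * Real.sqrt ν ≤ c₀ * s ^ (-(1 / q)) * s ^ (1 / 2 : ℝ) := h
      _ = c₀ * s ^ e := by
          rw [mul_assoc, ← Real.rpow_add hs0, he]; ring_nf
  have hcν : 0 < c * Real.sqrt ν := mul_pos hc (Real.sqrt_pos.2 hν)
  -- choose `s` small
  rcases eq_or_lt_of_le hc₀n with h0 | hc₀p
  · have := hs T ⟨hT, le_rfl⟩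
    rw [← h0, zero_mul] at this
    linarith
  · set s₁ : ℝ := (c * Real.sqrt ν / (2 * c₀)) ^ (1 / e) with hs₁
    have hs₁0 : 0 < s₁ := Real.rpow_pos_of_pos (by positivity) _
    set s : ℝ := min s₁ T with hsdef
    have hs0 : 0 < s := lt_min hs₁0 hT
    have hsT : s ≤ T := min_le_right _ _
    have hle := hs s ⟨hs0, hsT⟩
    have hse : s ^ e ≤ s₁ ^ e := Real.rpow_le_rpow hs0.le (min_le_left _ _) he0.le
    have hs₁e : s₁ ^ e = c * Real.sqrt ν / (2 * c₀) := by
      rw [hs₁, ← Real.rpow_mul (by positivity), one_div_mul_cancel he0.ne', Real.rpow_one]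
    have : c₀ * s ^ e ≤ c * Real.sqrt ν / 2 := by
      calc c₀ * s ^ e ≤ c₀ * s₁ ^ e := by gcongr
        _ = c * Real.sqrt ν / 2 := by rw [hs₁e]; field_simp
    linarith

/-! ### The energy bound and the pressure gauge on the frame -/

/-- The energy of every slice is bounded by twice the kinetic energy of the datum (the strong
solution is Leray–Hopf, §2.3 of the paper; energy inequality from `s = 0`).
[cite: LeslieShvydkoy2017, §2.3 (p. 8)] -/
theorem lintegral_sq_le_energy (hν : 0 ≤ ν) (hLH : IsLerayHopfOn T ν 0 (u 0) u) {t : ℝ}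
    (ht : t ∈ Icc 0 T) :
    ∫⁻ y, ‖u t y‖ₑ ^ 2 ≤ ENNReal.ofReal (2 * VectorCalculus.kineticEnergy (u 0)) := by
  obtain ⟨G, -, -, hE, -⟩ := hLH.weakGrad_energy
  have hE' : VectorCalculus.kineticEnergy (u t) +
      ν * (∫⁻ τ in Ioo 0 t, ∫⁻ x, ENNReal.ofReal (frobeniusNormSq (G τ x))).toReal ≤
        VectorCalculus.kineticEnergy (u 0) := by simpa using hE t ht
  have hKE : VectorCalculus.kineticEnergy (u t) ≤ VectorCalculus.kineticEnergy (u 0) := by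
    nlinarith [mul_nonneg hν (ENNReal.toReal_nonneg :
      0 ≤ (∫⁻ τ in Ioo 0 t, ∫⁻ x, ENNReal.ofReal (frobeniusNormSq (G τ x))).toReal)]
  have h := eEnergy_eq_ofReal _ (hLH.memLp t ht)
  rw [eEnergy] at h
  rw [h]
  exact ENNReal.ofReal_le_ofReal (by linarith)

/-- **The pressure gauge on a slab** (Tao 2011, Lemma 4.1 (i), the tree's
`tao_pressure_normalisation_holds`): for `0 < T' < T`, at a.e. `τ ∈ (0, T')` the classical
pressure differs from the normalised pressure by a constant. [cite: Tao2011, Lemma 4.1 (i)] -/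
theorem ae_pressure_gauge_slab (hν : 0 < ν) (hmax : IsMaximalSmoothSolution ν 0 u p T)
    (hLH : IsLerayHopfOn T ν 0 (u 0) u) {T' : ℝ} (hT' : T' ∈ Ioo 0 T) :
    ∀ᵐ τ ∂(volume.restrict (Ioo 0 T')), ∃ c : ℝ, ∀ x, p τ x - c = normalisedPressure (u τ) x := by
  have hsol' : IsClassicalNSSolutionOn (Icc 0 T') ν 0 u p :=
    hmax.1.mono (Icc_subset_Ico_right hT'.2) (uniqueDiffOn_Icc hT'.1)
  have hEn : ∃ Cₑ : ℝ≥0∞, Cₑ < ⊤ ∧ ∀ t ∈ Icc 0 T', ∫⁻ x, ‖u t x‖ₑ ^ 2 ≤ Cₑ :=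
    ⟨ENNReal.ofReal (2 * VectorCalculus.kineticEnergy (u 0)), ENNReal.ofReal_lt_top,
      fun t ht => lintegral_sq_le_energy hν.le hLH ⟨ht.1, ht.2.trans hT'.2.le⟩⟩
  obtain ⟨C, -, -, hae⟩ := tao_pressure_normalisation_holds ν T' hν hT'.1 u p hsol' hEn
  filter_upwards [ae_restrict_of_ae_restrict_of_subset Ioo_subset_Icc_self hae] with τ hτ
  exact ⟨C τ, fun x => by rw [hτ x]; ring⟩

/-! ### The kernel integral (3.13) -/

/-- `∫_{t₀}^{t} (T - τ)^{-1/q} dτ ≤ (T - t₀)^{1 - 1/q} / (1 - 1/q)` for `t₀ ≤ t < T`, `q > 1`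
((3.13): `(C₀/r)∫_{t₀}^0 f(τ)dτ ≤ C₀ c₀ q' t₀^{1/q'} r⁻¹`). [cite: LeslieShvydkoy2017, §3.4 (3.13) (p. 11)] -/
theorem integral_rate_le {t₀ t : ℝ} (hq : 1 < q) (htT : t < T) :
    ∫ τ in t₀..t, (T - τ) ^ (-(1 / q)) ≤ (T - t₀) ^ (1 - 1 / q) / (1 - 1 / q) := by
  have hq1 : 0 < 1 - 1 / q := by
    rw [sub_pos, div_lt_one (by linarith)]; exact hq
  have hr : (-1 : ℝ) < -(1 / q) := by
    rw [neg_lt_neg_iff, div_lt_one (by linarith)]; exact hq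
  rw [intervalIntegral.integral_comp_sub_left (fun x => x ^ (-(1 / q))) T,
    integral_rpow (Or.inl hr)]
  have e : -(1 / q) + 1 = 1 - 1 / q := by ring
  rw [e, div_le_div_iff_of_pos_right hq1]
  linarith [Real.rpow_nonneg (by linarith : (0 : ℝ) ≤ T - t) (1 - 1 / q)]

/-- The lower integral of the rate over `(t₀, t)`, `0 ≤ t₀ ≤ t < T`:
`∫⁻ ofReal (c₀ (T-τ)^{-1/q}) ≤ ofReal (c₀ (T-t₀)^{1-1/q}/(1-1/q))`, in particular finite.
[cite: LeslieShvydkoy2017, §3.4 (3.13) (p. 11)] -/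
theorem lintegral_rate_le (hc₀n : 0 ≤ c₀) (hq : 1 < q) {t₀ t : ℝ} (ht₀t : t₀ ≤ t) (htT : t < T) :
    ∫⁻ τ in Ioo t₀ t, ENNReal.ofReal (c₀ * (T - τ) ^ (-(1 / q))) ≤
      ENNReal.ofReal (c₀ * ((T - t₀) ^ (1 - 1 / q) / (1 - 1 / q))) := by
  -- the integrand is continuous on `[t₀, t]`
  have hcont : ContinuousOn (fun τ : ℝ => c₀ * (T - τ) ^ (-(1 / q))) (Icc t₀ t) := by
    refine continuousOn_const.mul (ContinuousOn.rpow_const (continuousOn_const.sub continuousOn_id)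
      fun τ hτ => Or.inl ?_)
    exact (sub_pos.2 (hτ.2.trans_lt htT)).ne'
  have hint : IntegrableOn (fun τ : ℝ => c₀ * (T - τ) ^ (-(1 / q))) (Ioo t₀ t) volume :=
    (hcont.integrableOn_compact isCompact_Icc).mono_set Ioo_subset_Icc_self
  have hnn : 0 ≤ᵐ[volume.restrict (Ioo t₀ t)] fun τ : ℝ => c₀ * (T - τ) ^ (-(1 / q)) := by
    refine ae_restrict_of_forall_mem measurableSet_Ioo fun τ hτ => ?_
    exact mul_nonneg hc₀n (Real.rpow_nonneg (by linarith [hτ.2]) _)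
  rw [← ofReal_integral_eq_lintegral_ofReal hint hnn, ← integral_Ioc_eq_integral_Ioo,
    ← intervalIntegral.integral_of_le ht₀t, intervalIntegral.integral_const_mul]
  exact ENNReal.ofReal_le_ofReal (mul_le_mul_of_nonneg_left (integral_rate_le hq htT) hc₀n)

end LeslieShvydkoy2018

end Literature.Analysis.FluidPDE

end
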